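import Summits.HodgeConjecture.HodgeConjecture.Theorems.SignSymmetricPowersGenPairCentre
import HarnessLib

/-!
# K1-B meridian package, G2 part (d'): the pair centre for the SIGN family
# (route `SignSymmetricPowers`, item stmt-HodgeConjecture-19716; helper for GEN / LINK-G)

Helper file (`--supports stmt-HodgeConjecture-19716`).  Specialisation of
`SignSymmetricPowersGenPairCentre.exists_unique_factor_pair` to the objects of the registered stubs GEN
(`stub_signMeridianGeneration`) and LINK-G (`stub_signConfluenceLinkG`): `n = 3`, the ι-even monomials
`M = {m | m₀ + m₁ even}`, `γ = (−1,−1,1,1,1)`, the exchanged pair of nodes `q = (1,0,1,0,0)`, `q' = (−1,0,1,0,0)` of the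
pair-type nodal form `f₃` (`IsNodalFormWithNodes f₃ ![q, q']`), with separating form `(x₀ + x₂)^d` and chart monomial
`x₂^d`; the pencil direction `g` is any `M`-supported degree-`d` form with `g(q) ≠ 0` (then `g(q') = g(q) ≠ 0` by
ι-invariance).

* `exists_unique_factor_signPair` — for `D_M = killHom Disc = w · ∏ⱼ hⱼ^{eⱼ}` (unit `w`, pairwise non-associated
  irreducible `hⱼ`, `eⱼ ≥ 1`), GRANTED F-DISC-1: exactly one `h_{j₀}` vanishes at `coeff_M f₃`, `e_{j₀} = 2`, and
  `Σ_k ∂_k h_{j₀}(coeff_M f₃) · coeff_M(g)_k ≠ 0` (the `Meridian` fields `eval_center`, `eval_center_ne`, `transversal`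
  of the pair pencil circle).

Sorry-free; axioms standard; no definition, no named fact.

## References

* [VoisinHodgeII2003] C. Voisin, Hodge Theory and Complex Algebraic Geometry II (CUP 2003), §2.1.1, §2.3.1.
-/

noncomputable section

set_option linter.dupNamespace false

open MvPolynomial
open Literature.AlgebraicGeometry.Motives Literature.AlgebraicGeometry.Motives.UniversalHypersurface
open Literature.AlgebraicGeometry.HodgeTheory
open Summit.HodgeConjecture.HodgeConjecture.Theorems.SignSymmetricPowersGenDiagonalCoeff
open Summit.HodgeConjecture.HodgeConjecture.Theorems.SignSymmetricPowersGenPairCentre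

namespace Summit.HodgeConjecture.HodgeConjecture.Theorems.SignSymmetricPowersGenPairCentreSign

/-- **Pair centre, sign family.**  See the module docstring.
[cite: VoisinHodgeII2003, §2.1.1 Lemma 2.7, Cor. 2.8 and pp. 69–70] -/
theorem exists_unique_factor_signPair (hB : discriminant_localBranches_nodal) {d : ℕ} (hd : 1 ≤ d)
    {Disc : MvPolynomial (DegIndex 3 d) ℂ} (hirr : Irreducible Disc)
    (hV : ∀ a : DegIndex 3 d → ℂ, a ∈ singularCoeffs 3 d ↔ MvPolynomial.eval a Disc = 0)
    (hγ : FixesMonomials ℂ 3 d {m : DegIndex 3 d | Even (m.1 0 + m.1 1)}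
      (fun i : Fin 5 => if (i : ℕ) < 2 then -1 else 1))
    {m : ℕ} (w : MvPolynomial {m : DegIndex 3 d | Even (m.1 0 + m.1 1)} ℂ) (hw : IsUnit w)
    (h : Fin m → MvPolynomial {m : DegIndex 3 d | Even (m.1 0 + m.1 1)} ℂ) (e : Fin m → ℕ)
    (hirrh : ∀ j, Irreducible (h j)) (hna : ∀ i j, i ≠ j → ¬ Associated (h i) (h j)) (he : ∀ j, 1 ≤ e j)
    (hfac : killHom ℂ 3 d {m : DegIndex 3 d | Even (m.1 0 + m.1 1)} Disc = w * ∏ j, h j ^ e j)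
    {f₃ : MvPolynomial (Fin 5) ℂ} (hf₃ : f₃.IsHomogeneous d)
    (hM₃ : IsSupportedOn 3 d {m : DegIndex 3 d | Even (m.1 0 + m.1 1)} f₃)
    (hnod : IsNodalFormWithNodes f₃ ![![1, 0, 1, 0, 0], ![-1, 0, 1, 0, 0]])
    {g : MvPolynomial (Fin 5) ℂ} (hg : g.IsHomogeneous d)
    (hMg : IsSupportedOn 3 d {m : DegIndex 3 d | Even (m.1 0 + m.1 1)} g)
    (hgq : MvPolynomial.eval ![1, 0, 1, 0, 0] g ≠ 0) :
    haveI : Fintype {m : DegIndex 3 d | Even (m.1 0 + m.1 1)} := Subtype.fintype _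
    ∃ j₀, MvPolynomial.eval (fun m' : {m : DegIndex 3 d | Even (m.1 0 + m.1 1)} => coeff m'.1.1 f₃) (h j₀) = 0 ∧
      e j₀ = 2 ∧
      (∀ i, i ≠ j₀ →
        MvPolynomial.eval (fun m' : {m : DegIndex 3 d | Even (m.1 0 + m.1 1)} => coeff m'.1.1 f₃) (h i) ≠ 0) ∧
      ∑ k, MvPolynomial.eval (fun m' : {m : DegIndex 3 d | Even (m.1 0 + m.1 1)} => coeff m'.1.1 f₃)
          (pderiv k (h j₀)) * (fun m' : {m : DegIndex 3 d | Even (m.1 0 + m.1 1)} => coeff m'.1.1 g) k ≠ 0 := by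
  classical
  set γ : Fin 5 → ℂˣ := fun i : Fin 5 => if (i : ℕ) < 2 then -1 else 1 with hγdef
  -- the exchanged nodes
  have hq' : (fun i => (γ i : ℂ) * (![1, 0, 1, 0, 0] : Fin 5 → ℂ) i) = ![-1, 0, 1, 0, 0] := by
    funext i; fin_cases i <;> simp [hγdef]
  have hq : (fun i => (γ i : ℂ) * (![-1, 0, 1, 0, 0] : Fin 5 → ℂ) i) = ![1, 0, 1, 0, 0] := by
    funext i; fin_cases i <;> simp [hγdef]
  -- the separating form `(x₀ + x₂)^d`
  have hsep : ((X 0 + X 2) ^ d : MvPolynomial (Fin 5) ℂ).IsHomogeneous d := by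
    simpa using ((isHomogeneous_X ℂ (0 : Fin 5)).add (isHomogeneous_X ℂ (2 : Fin 5))).pow d
  have hsepq : MvPolynomial.eval (![1, 0, 1, 0, 0] : Fin 5 → ℂ) ((X 0 + X 2) ^ d) ≠ 0 := by
    rw [map_pow, map_add, eval_X, eval_X]
    have h2 : (![1, 0, 1, 0, 0] : Fin 5 → ℂ) 0 + (![1, 0, 1, 0, 0] : Fin 5 → ℂ) 2 = 2 := by
      simp [Matrix.cons_val_zero]; norm_num
    rw [h2]
    exact pow_ne_zero d two_ne_zero
  have hsepq' : MvPolynomial.eval (![-1, 0, 1, 0, 0] : Fin 5 → ℂ) ((X 0 + X 2) ^ d) = 0 := by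
    rw [map_pow, map_add, eval_X, eval_X]
    have h2 : (![-1, 0, 1, 0, 0] : Fin 5 → ℂ) 0 + (![-1, 0, 1, 0, 0] : Fin 5 → ℂ) 2 = 0 := by
      simp [Matrix.cons_val_zero]
    rw [h2]
    exact zero_pow (by omega)
  -- the chart monomial `x₂^d ∈ M`
  have hdeg : (Finsupp.single (2 : Fin 5) d).degree = d := by simp
  have hm₀M : (⟨Finsupp.single 2 d, hdeg⟩ : DegIndex 3 d) ∈ {m : DegIndex 3 d | Even (m.1 0 + m.1 1)} := by
    show Even ((Finsupp.single (2 : Fin 5) d) 0 + (Finsupp.single (2 : Fin 5) d) 1)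
    simp
  have hm₀ : MvPolynomial.eval (![1, 0, 1, 0, 0] : Fin 5 → ℂ)
      (monomial (⟨⟨Finsupp.single 2 d, hdeg⟩, hm₀M⟩ : {m : DegIndex 3 d | Even (m.1 0 + m.1 1)}).1.1 (1 : ℂ)) ≠ 0 := by
    simp [eval_monomial]
  -- `g(q') = g(q)` by ι-invariance
  have hgq2 : MvPolynomial.eval (![-1, 0, 1, 0, 0] : Fin 5 → ℂ) g ≠ 0 := by
    have hinv : aeval (diagSubstK ℂ 3 γ) g = g := aeval_diagSubstK_of_isSupportedOn hγ hg hMg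
    have := eval_aeval_diagSubstK γ g ![1, 0, 1, 0, 0]
    rw [hinv, hq'] at this
    rw [← this]; exact hgq
  exact exists_unique_factor_pair 3 d {m : DegIndex 3 d | Even (m.1 0 + m.1 1)} hB hirr hV hγ w hw h e hirrh hna he
    hfac hf₃ hM₃ hq' hq hnod hsep hsepq hsepq' ⟨⟨Finsupp.single 2 d, hdeg⟩, hm₀M⟩ hm₀ hg hMg hgq hgq2

end Summit.HodgeConjecture.HodgeConjecture.Theorems.SignSymmetricPowersGenPairCentreSign

end
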